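import Summits.ResolutionOfSingularities.ResolutionOfSingularities.Theorems.EquisingularLiftEquisingularLiftNatF102FibreCoordinate
import Literature.AlgebraicGeometry.Morphisms.CechH1Projective
import HarnessLib

/-!
# [OURS · L1 W4.5(b) · LINE (T-j)-PROOF · BRICK S5b (β)] The chart map of `e⁻¹ ≫ i ≫ φ` is onto

Setting of res-L1-w45b-lead-2's F-102 skeleton (v3): `φ : C → ℙ¹_O` the morphism of BRICK S5a (`φ⁻¹ D₊(X_j) = U_j`, chart
image `closure(O ∪ {t_j})`), `e : C_k ≅ ℙ¹_{k'}`, and BRICK S5b's identification of the special fibre of the coordinate,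
`(e⁻¹ ≫ i)^* t_j = c · (x_{j'}/x_j)` with `c ≠ 0`.  GIVEN that the constants of `k'` are hit by `k` through `e⁻¹ ≫ t` on the
chart (hypothesis `hconst`, the (α′)-lemma of the S5b cut), the chart map
`Γ(ℙ¹_O, D₊(X_j)) → Γ(ℙ¹_{k'}, D₊(x_j))` of `e⁻¹ ≫ i ≫ φ` is SURJECTIVE (`chart_appLE_surjective`): its image is a subring
containing every constant and `c⁻¹ · (c · x_{j'}/x_j) = x_{j'}/x_j`, hence everything (`Γ(D₊(x_j)) = k'[x_{j'}/x_j]`).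
Helper for stmt-ResolutionOfSingularities-20148 (EL♮(3)) via F-102; no new definitions.
-/

set_option linter.dupNamespace false

noncomputable section

open CategoryTheory AlgebraicGeometry HomogeneousLocalization TopologicalSpace Opposite IsLocalRing
open MvPolynomial (X C)
open Literature.AlgebraicGeometry.Morphisms Literature.AlgebraicGeometry.Motives Literature.AlgebraicGeometry.Motives.Segre
open Literature.AlgebraicGeometry.Motives.ProjLine

universe u

attribute [local instance] MvPolynomial.gradedAlgebra MvPolynomial.algebraMvPolynomial
  Literature.AlgebraicGeometry.Motives.ProjBaseChange.algebraBase

namespace Summit.ResolutionOfSingularities.ResolutionOfSingularities.Cruxes.EquisingularLiftNat.F102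

/-- On `ℙ¹_k`: the constants of the chart ring `(k[x₀,x₁]_{(xᵢ)})₀` are `Segre.cst`. [folklore] -/
theorem ProjLine.algebraMap_away_eq_cst (k : Type u) [Field k] (i : Fin 2) (a : k) :
    algebraMap k (Away (A k) (X i)) a = Segre.cst k (X i) a := rfl

/-- On `ℙ¹_k`: `ψ'⁻¹(T) = x_j/x_i`, so `awayToSection (ψ'⁻¹ T) = sec`. [folklore] -/
theorem ProjLine.awayToSection_symm_X (k : Type u) [Field k] (i : Fin 2) :
    Proj.awayToSection (A k) (X i) ((ψ' k i).symm Polynomial.X) = sec k i := by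
  rw [sec, ← ψ'_e k i, AlgEquiv.symm_apply_apply]

/-- On `ℙ¹_k`: **`Γ(ℙ¹, D₊(xᵢ))` is generated by the constants and `x_j/xᵢ`** — a subring containing every
`awayToSection (cst a)` and `sec` is everything. [folklore] -/
theorem ProjLine.eq_top_of_cst_mem_of_sec_mem (k : Type u) [Field k] (i : Fin 2)
    (T : Subring Γ(P k, Proj.basicOpen (A k) (X i)))
    (hcst : ∀ a : k, Proj.awayToSection (A k) (X i) (Segre.cst k (X i) a) ∈ T) (hsec : sec k i ∈ T) : T = ⊤ := by
  refine eq_top_iff.mpr fun x hx => ?_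
  clear hx
  obtain ⟨b, rfl⟩ := awayToSection_surjective k i x
  obtain ⟨p, rfl⟩ : ∃ p : Polynomial k, (ψ' k i).symm p = b := ⟨ψ' k i b, (ψ' k i).symm_apply_apply b⟩
  induction p using Polynomial.induction_on' with
  | add p q hp hq => rw [map_add, map_add]; exact T.add_mem hp hq
  | monomial n a =>
    rw [← Polynomial.C_mul_X_pow_eq_monomial, map_mul, map_pow, map_mul, map_pow, ProjLine.awayToSection_symm_X,
      ← Polynomial.algebraMap_eq, AlgEquiv.commutes, ProjLine.algebraMap_away_eq_cst]
    exact T.mul_mem (hcst a) (T.pow_mem hsec n)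

/-- **BRICK S5b (β): the chart map of `e⁻¹ ≫ i ≫ φ` is onto.** With `φ⁻¹ D₊(X_j) = U`, the chart image of `φ` equal to
`closure(O|_U ∪ {t_U})` (BRICK S5a), `(e⁻¹ ≫ i)^* t_U = c · (x_{j'}/x_j)` with `c ≠ 0` (BRICK S5b) and the constants of `k'`
hit by `k` through `e⁻¹ ≫ t` (hypothesis `hconst`): `Γ(ℙ¹_O, D₊(X_j)) → Γ(ℙ¹_{k'}, D₊(x_j))` is surjective. [OURS] -/
theorem chart_appLE_surjective (O : Type) [CommRing O] (k : Type) [Field k] (θ : O →+* k)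
    (hθ : Function.Surjective θ) {C Ck : Scheme.{0}} (f : C ⟶ Spec (.of O)) (i : Ck ⟶ C) (t : Ck ⟶ Spec (.of k))
    (hsq : IsPullback i t f (Spec.map (CommRingCat.ofHom θ))) (k' : Type) [Field k'] (e : Ck ≅ ProjCech.PP k' 1)
    (φ : C ⟶ ProjCech.PP O 1) (j : Fin 2) (U : C.Opens) (hUφ : φ ⁻¹ᵁ Proj.basicOpen (grading (Fin 2) O) (X j) = U)
    (tU : Γ(C, U))
    (hrange : (φ.appLE (Proj.basicOpen (grading (Fin 2) O) (X j)) U (le_of_eq hUφ.symm)).hom.range =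
      Subring.closure (Set.range ((C.presheaf.map (homOfLE (le_top : U ≤ ⊤)).op).hom.comp (pull f)) ∪ {tU}))
    (hU : Proj.basicOpen (A k') (X j) ≤ (e.inv ≫ i) ⁻¹ᵁ U) (c : k') (hc : c ≠ 0)
    (htU : (e.inv ≫ i).appLE U (Proj.basicOpen (A k') (X j)) hU tU =
      Proj.awayToSection (A k') (X j) (Segre.cst k' (X j) c) * sec k' j)
    (hconst : ∀ c' : k', ∃ κ : k, (e.inv ≫ t).appLE ⊤ (Proj.basicOpen (A k') (X j)) le_top
      ((Scheme.ΓSpecIso (.of k)).inv κ) = Proj.awayToSection (A k') (X j) (Segre.cst k' (X j) c'))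
    (hle : Proj.basicOpen (A k') (X j) ≤ (e.inv ≫ i ≫ φ) ⁻¹ᵁ Proj.basicOpen (grading (Fin 2) O) (X j)) :
    Function.Surjective ((e.inv ≫ i ≫ φ).appLE (Proj.basicOpen (grading (Fin 2) O) (X j))
      (Proj.basicOpen (A k') (X j)) hle) := by
  set ψ := (e.inv ≫ i).appLE U (Proj.basicOpen (A k') (X j)) hU with hψ
  -- the image of `φ`'s chart ring under `ψ` is everything
  set T : Subring Γ(ProjCech.PP k' 1, Proj.basicOpen (A k') (X j)) :=
    (φ.appLE (Proj.basicOpen (grading (Fin 2) O) (X j)) U (le_of_eq hUφ.symm)).hom.range.map ψ.hom with hT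
  have hw : (e.inv ≫ i) ≫ f = (e.inv ≫ t) ≫ Spec.map (CommRingCat.ofHom θ) := by
    rw [Category.assoc, hsq.w, Category.assoc]
  -- constants
  have hcstT : ∀ a : k', Proj.awayToSection (A k') (X j) (Segre.cst k' (X j) a) ∈ T := fun a => by
    obtain ⟨κ, hκ⟩ := hconst a
    obtain ⟨o, rfl⟩ := hθ κ
    rw [← hκ, hT]
    refine Subring.mem_map.mpr ⟨C.presheaf.map (homOfLE (le_top : U ≤ ⊤)).op (pull f o), ?_, ?_⟩
    · rw [hrange]
      exact Subring.subset_closure (Or.inl ⟨o, rfl⟩)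
    · have key : ∀ z : Γ(Spec (.of O), ⊤),
          ψ (C.presheaf.map (homOfLE (le_top : U ≤ ⊤)).op (f.appTop z)) =
            (ProjCech.PP k' 1).presheaf.map (homOfLE (le_top : Proj.basicOpen (A k') (X j) ≤ ⊤)).op
              ((e.inv ≫ t).appTop ((Spec.map (CommRingCat.ofHom θ)).appTop z)) := fun z => by
        rw [hψ, ← CommRingCat.comp_apply, Scheme.Hom.map_appLE]
        simp only [Scheme.Hom.appLE, CommRingCat.comp_apply]
        have h3 : (e.inv ≫ i).app ⊤ (f.appTop z) = (e.inv ≫ t).app ⊤ ((Spec.map (CommRingCat.ofHom θ)).appTop z) := by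
          change ((e.inv ≫ i) ≫ f).appTop z = ((e.inv ≫ t) ≫ Spec.map (CommRingCat.ofHom θ)).appTop z
          rw [hw]
        rw [h3]
        rfl
      have h2 := congrArg (fun g => g.hom o) (Scheme.ΓSpecIso_inv_naturality (CommRingCat.ofHom θ))
      simp only [CommRingCat.hom_comp, RingHom.comp_apply, CommRingCat.hom_ofHom] at h2
      rw [pull_apply, key, ← h2]
      rfl
  -- the coordinate
  have hsecT : sec k' j ∈ T := by
    have hmem : Proj.awayToSection (A k') (X j) (Segre.cst k' (X j) c) * sec k' j ∈ T := by
      rw [← htU, hT]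
      refine Subring.mem_map.mpr ⟨tU, ?_, rfl⟩
      rw [hrange]
      exact Subring.subset_closure (Or.inr rfl)
    have h1 : sec k' j = Proj.awayToSection (A k') (X j) (Segre.cst k' (X j) c⁻¹) *
        (Proj.awayToSection (A k') (X j) (Segre.cst k' (X j) c) * sec k' j) := by
      rw [← mul_assoc, ← map_mul, ← map_mul, inv_mul_cancel₀ hc, map_one, map_one, one_mul]
    rw [h1]
    exact T.mul_mem (hcstT _) hmem
  have hTtop : T = ⊤ := ProjLine.eq_top_of_cst_mem_of_sec_mem k' j T hcstT hsecT
  -- conclude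
  intro x
  have hx : x ∈ T := by rw [hTtop]; trivial
  rw [hT] at hx
  obtain ⟨y, ⟨a, rfl⟩, hya⟩ := Subring.mem_map.mp hx
  refine ⟨a, ?_⟩
  rw [← hya, hψ, ← CommRingCat.comp_apply, Scheme.Hom.appLE_comp_appLE]
  rfl

end Summit.ResolutionOfSingularities.ResolutionOfSingularities.Cruxes.EquisingularLiftNat.F102

end
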